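import Literature.MathematicalPhysics.QuantumFieldTheory.Balaban1983to89.B9Thm311CoerciveCompactZd

/-!
# `Balaban1983to89.B9Thm33GreenL2BoundCubeZd` — [Balaban1985BackgroundPropagators] THEOREM 3.3 p. 399, (3.42) AT `n = 0` IN THE `L²_τ` CURRENCY, AT THE `ℤᵈ × 𝔸` CARRIER:
# THE GENUINE `G_𝔤(U₀) = (□₀Δ_a(U₀)□₀)⁻¹` IS A BOUNDED OPERATOR OF `L²_τ`, `‖G_𝔤(U₀)J‖_τ ≤ c⁻¹‖J‖_τ`, WITH ONE CONSTANT FOR EVERY UNITARY BACKGROUND WITH SMALL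
# PLAQUETTE VARIABLES NEAR THE MEMBER — the coercivity constant of `B9Thm311CoerciveCompactZd` read through the Cauchy–Schwarz inequality of the pairing `⟨·,·⟩_τ`

statement-level skeleton of published theorems with citation tags; proofs where landed; nothing here is a claim about the
Yang–Mills mass gap

`[Balaban1985BackgroundPropagators]` ("B9", CMP **99** (1985) 389–434) p. 399, Theorem 3.3: *«There exist constants … such that … the operator G(U) satisfies
(3.42)–(3.47)»*, with (3.42) p. 397 the pointwise exponential bound `|(∇^η_U)ⁿ G(U; x, x′)| ≤ …`, whose `n = 0`, un-localised content is the boundedness of `G(U)`;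
p. 395 (3.27) `G = (Δ_a↾Ω₀)⁻¹`; p. 416 Thm 3.11.  `[Balaban1984PropagatorsII]` ("[4]", CMP **96**) p. 226: *«the operator Δ_a is bounded from below by a positive
constant, hence … G = Δ_a⁻¹»* and (2.22) (`‖G‖ ≤ γ⁻¹`).  This file proves exactly that «hence»: a lower form bound `c` gives `‖G‖_{L²_τ→L²_τ} ≤ c⁻¹`.  PDF held:
`paper:balaban1985-cmp99-background-propagators` pp. 395–399, 416 (re-read by this seat, 2026-08-28).

CITATION HEADER (lean-in-tree rule).  Cell `pub-ymgap` (YM Track A, HUMAN RULING D-0062 ∕ D-0149 width push), DAG node N06 = [B9], width seat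
`pub-ymgap-dag-n06-w4` (g4), CLAIM-3 ∕ INTENT-3.  Inputs BY NAME: this seat's g4 `B9Thm311CoerciveCompactZd.exists_coercive_and_regularAtH_of_pdevOn_lt_cube` (the constant
`c` and the existence of `G_𝔤(U₀)`), dag-n06-b's `B9Eq327GreenZdHerm` (`gopZdH`, `deltaAEquivH`, `restrictLinH`), g2's `B9Eq327GreenZd` (`⟨·,·⟩_τ = bondPair`,
`bondPair_restrictDom_right`), `B9Thm311FlatHermKernelZd.bondPair_eq_sum_of_vanish_off`, `B9Eq316AveragingTransposeZd.tauForm`.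

WHAT IS PROVED (kernel, 0 sorry; theorems only — no `def`, `instance`, `notation`).
* §1 (`[folklore]`) `sum_tauForm_self_nonneg`, ★ `sum_tauForm_sq_le` (CAUCHY–SCHWARZ for the finite `τ`-pairing `Σ_{i∈T} Re τ(F(i)* G(i))` over ANY finite index set,
  Hermitian faithful `τ`, by the discriminant), ★★ `bondPair_sq_le` (`⟨A, B⟩_τ² ≤ ⟨A, A⟩_τ·⟨B, B⟩_τ` for bond fields vanishing off a finite bond set — e.g. on `E(Ω₀)`,
  finite `Ω₀`), `bondPair_self_nonneg_of_vanish_off`.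
* §2 (carrier, ANY record `o`, finite `Ω₀`) `coe_deltaAEquivH_symm_gopZdH` ∕ `deltaADom_gopZdH` (`□₀Δ_a(U₀)□₀ (G_𝔤(U₀)J) = herm 𝟙_{Ω₀}J` in the regime),
  ★★ `bondPair_gopZdH_self_le_of_coercive` (AT ONE BACKGROUND: `RegularAtH` + `c`-coercivity on `E_𝔤(Ω₀)` ⟹ `⟨GJ, GJ⟩_τ ≤ c⁻²·⟨J̃, J̃⟩_τ`, `J̃ = herm 𝟙_{Ω₀}J`),
  ★★ `bondPair_gopZdH_self_le_of_coercive_of_mem` (for `J ∈ E_𝔤(Ω₀)`: `‖G_𝔤(U₀)J‖²_τ ≤ c⁻²‖J‖²_τ`).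
* §3 (cube members, the genuine four-letter `Δ_a` of `opsAllZd` at print's class `cubeLamBP`) ★★★★ `exists_L2Bound_gopZdH_of_pdevOn_lt_cube` — THERE ARE `α > 0` AND `c > 0`
  (member-dependent) SUCH THAT FOR EVERY UNITARY `U₀` WITH `‖U₀(∂p) − 1‖ < α` ON THE PLAQUETTES OF `□₀ ± 3` AND EVERY HERMITIAN `J ∈ E(□₀)`:
  `⟨G_𝔤(U₀)J, G_𝔤(U₀)J⟩_τ ≤ c⁻²·⟨J, J⟩_τ` — (3.42)'s `n = 0` content as an `L²_τ` OPERATOR BOUND, one constant for the whole local small-field class;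
  `L2Bound_gopZdH_one_cube` (A6: at `U₀ = 1`).

HONEST SCOPE.  (i) An `L²_τ → L²_τ` bound ONLY: no pointwise kernel bound, no exponential decay in `|x − x′|`, no covariant derivatives (`n = 1, 2`), no Hölder
norms — i.e. NOT (3.42)–(3.47) as printed; those need the random-walk expansion (Sects. C–E) or a Combes–Thomas step on top of the present constant (dag-n06-w2 g4's
STATION road).  (ii) `α, c` MEMBER-DEPENDENT and NON-QUANTITATIVE (compactness); print's constants are uniform in the member.  (iii) `τ` is a PARAMETER; no
instance.  (iv) A6: inhabited at `U₀ = 1` at every member.  (v) Count-neutral helper (`--supports stmt-QuantumFields-20542`); N05 ∕ N06 NOT discharged; K1⁷ NOT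
closed; one finite `𝕋⁴` programme at fixed `ε`, Bałaban as printed; R4 closes only the conditional finite-`𝕋⁴` rung `BalabanLadder.UV` — nothing continuum ∕ ℝ⁴ ∕
OS ∕ mass gap ∕ Clay.  Unit `pub-ymgap-dag-n06-w4` (g4), 2026-08-28.
-/

noncomputable section

namespace Literature.MathematicalPhysics.QuantumFieldTheory.Balaban1983to89.B9Thm33GreenL2BoundCubeZd

open Filter Topology
open B7Prop1Explicit
open B7Prop1Local (pdevOn)
open B7Prop2Explicit (unitaryUnits)
open B8Ineq132 (BondTouches)
open B8Eq131Cubes (sqLo sqHi)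
open B8Eq131CubesAdmissible (cubeFam)
open B8CubeMemberZd (cubeLamS)
open B8Ineq159FlatCubeMemberPrinted (cubeLamBP)
open B8LeafModelZd (ZdIdx)
open B9SupplySockB9P3ZdLetters (OpsZd deltaAOf)
open B9SupplySockB9P3ZdLettersOmega (restrictDom)
open B9SupplySockB9P3ZdAllLettersZd (opsAllZd)
open B9Eq316AveragingTransposeZd (tauForm tauForm_apply tauForm_isSymm)
open B9Eq327GreenZd (domSub bondPair deltaADom setOf_bondTouches_finite bondPair_restrictDom_right restrictDom_eq_self_of_mem)
open B9Eq327GreenZdHerm (domSubH domSubH_le RegularAtH deltaAEquivH deltaAEquivH_coe gopZdH gopZdH_of_regularAtH gopZdH_mem_domSubH restrictLinH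
  restrictLinH_coe_of_herm)
open B9Thm311PosDefOpenZd (cubeMember_Ω0_finite eq_zero_of_not_mem_bondFinset)
open B9Thm311FlatHermKernelZd (bondPair_eq_sum_of_vanish_off)
open B9Thm311CoerciveCompactZd (exists_coercive_and_regularAtH_of_pdevOn_lt_cube pdevOn_one)

-- `Site` alone could resolve to the torus sites of `Setup.lean`; re-export the `ℤ^d` sites of `B7Prop1Explicit`.
export B7Prop1Explicit (Site)

variable {d : ℕ} {𝔸 : Type*} [CStarAlgebra 𝔸]

/-! ## §1  Cauchy–Schwarz for the `τ`-pairing of finitely supported bond fields -/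

section CauchySchwarz

variable (τ : 𝔸 →ₗ[ℂ] ℂ) (hτp : ∀ a : 𝔸, a ≠ 0 → 0 < (τ (star a * a)).re) (hτs : ∀ a : 𝔸, τ (star a) = starRingEnd ℂ (τ a))

include hτp in
/-- the finite `τ`-pairing of a family with itself is non-negative (any finite index set). [cite: Balaban1985BackgroundPropagators, p.390 («|X|² = tr X*X»)] -/
theorem sum_tauForm_self_nonneg {ι : Type*} (T : Finset ι) (F : ι → 𝔸) : 0 ≤ ∑ i ∈ T, tauForm τ (F i) (F i) := by
  refine Finset.sum_nonneg fun i _ => ?_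
  rw [tauForm_apply]
  by_cases h : F i = 0
  · rw [h, mul_zero, map_zero, Complex.zero_re]
  · exact (hτp _ h).le

include hτp hτs in
/-- ★ **CAUCHY–SCHWARZ FOR THE FINITE `τ`-PAIRING** `S(F, G) = Σ_{i∈T} Re τ(F(i)* G(i))` over ANY finite index set (sites, bonds, level-sites; Hermitian faithful
`τ`): `S(F, G)² ≤ S(F, F)·S(G, G)` — the discriminant of the non-negative quadratic `t ↦ S(F − tG, F − tG)`.
[cite: Balaban1985BackgroundPropagators, p.391 («X·Y = tr XY» — a scalar product; Cauchy–Schwarz, folklore)] -/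
theorem sum_tauForm_sq_le {ι : Type*} (T : Finset ι) (F G : ι → 𝔸) :
    (∑ i ∈ T, tauForm τ (F i) (G i)) ^ 2 ≤ (∑ i ∈ T, tauForm τ (F i) (F i)) * ∑ i ∈ T, tauForm τ (G i) (G i) := by
  set sAB := ∑ i ∈ T, tauForm τ (F i) (G i) with hsAB
  set sAA := ∑ i ∈ T, tauForm τ (F i) (F i) with hsAA
  set sBB := ∑ i ∈ T, tauForm τ (G i) (G i) with hsBB
  have hsymm : ∀ x y : 𝔸, tauForm τ y x = tauForm τ x y := fun x y => ((tauForm_isSymm τ hτs).eq y x)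
  -- the quadratic `t ↦ S(F − tG, F − tG) = sBB·t² − 2 sAB·t + sAA ≥ 0`
  have hquad : ∀ t : ℝ, 0 ≤ sBB * (t * t) + (-2 * sAB) * t + sAA := by
    intro t
    have h0 := sum_tauForm_self_nonneg τ hτp T (F - t • G)
    have hexp : ∑ i ∈ T, tauForm τ ((F - t • G) i) ((F - t • G) i) = sBB * (t * t) + (-2 * sAB) * t + sAA := by
      have hb : ∀ i ∈ T, tauForm τ ((F - t • G) i) ((F - t • G) i) =
          tauForm τ (G i) (G i) * (t * t) + (-2 * tauForm τ (F i) (G i)) * t + tauForm τ (F i) (F i) := by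
        intro i _
        simp only [Pi.sub_apply, Pi.smul_apply, map_sub, map_smul, LinearMap.sub_apply, LinearMap.smul_apply, smul_eq_mul]
        rw [hsymm (F i) (G i)]
        ring
      rw [Finset.sum_congr rfl hb, Finset.sum_add_distrib, Finset.sum_add_distrib, ← Finset.sum_mul, ← Finset.sum_mul, hsBB, hsAB, hsAA,
        Finset.mul_sum, Finset.sum_mul]
    rw [hexp] at h0
    exact h0
  have hdisc := discrim_le_zero hquad
  rw [discrim] at hdisc
  nlinarith [hdisc]

include hτp hτs in
/-- ★★ **CAUCHY–SCHWARZ FOR `⟨·,·⟩_τ` ON BOND FIELDS VANISHING OFF A FINITE BOND SET** (e.g. `E(Ω₀)` for finite `Ω₀`): `⟨A, B⟩_τ² ≤ ⟨A, A⟩_τ·⟨B, B⟩_τ`.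
[cite: Balaban1985BackgroundPropagators, p.391, (3.17) p.393 (Cauchy–Schwarz for the printed scalar product, folklore)] -/
theorem bondPair_sq_le (T : Finset (Site d × Fin d)) {A B : Site d → Fin d → 𝔸} (hA : ∀ b : Site d × Fin d, b ∉ T → A b.1 b.2 = 0)
    (hB : ∀ b : Site d × Fin d, b ∉ T → B b.1 b.2 = 0) :
    (bondPair τ A B) ^ 2 ≤ bondPair τ A A * bondPair τ B B := by
  rw [bondPair_eq_sum_of_vanish_off τ T hA B, bondPair_eq_sum_of_vanish_off τ T hA A, bondPair_eq_sum_of_vanish_off τ T hB B]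
  exact sum_tauForm_sq_le τ hτp hτs T (fun b => A b.1 b.2) (fun b => B b.1 b.2)

include hτp in
/-- `⟨A, A⟩_τ ≥ 0` for a bond field vanishing off a finite bond set. [cite: Balaban1985BackgroundPropagators, p.390 («|X|² = tr X*X»)] -/
theorem bondPair_self_nonneg_of_vanish_off (T : Finset (Site d × Fin d)) {A : Site d → Fin d → 𝔸} (hA : ∀ b : Site d × Fin d, b ∉ T → A b.1 b.2 = 0) :
    0 ≤ bondPair τ A A := by
  rw [bondPair_eq_sum_of_vanish_off τ T hA A]
  exact sum_tauForm_self_nonneg τ hτp T fun b => A b.1 b.2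

end CauchySchwarz

/-! ## §2  At one background: coercivity + regularity ⟹ `‖G_𝔤(U₀)J‖_τ ≤ c⁻¹‖J‖_τ` -/

section OneBackground

variable (τ : 𝔸 →ₗ[ℂ] ℂ) (hτp : ∀ a : 𝔸, a ≠ 0 → 0 < (τ (star a * a)).re) (hτs : ∀ a : 𝔸, τ (star a) = starRingEnd ℂ (τ a))
variable (η : ℝ) (o : OpsZd d 𝔸) (Ω₀ : Set (Site d)) (U₀ : Site d → Fin d → 𝔸ˣ)

/-- in the regime, `G_𝔤(U₀)J` is (the value of) the preimage of `herm 𝟙_{Ω₀}J` under the invertible operator of `RegularAtH`.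
[cite: Balaban1985BackgroundPropagators, (3.27) p.395 (bookkeeping)] -/
theorem coe_deltaAEquivH_symm_gopZdH (h : RegularAtH η o Ω₀ U₀) (J : Site d → Fin d → 𝔸) :
    ((deltaAEquivH η o Ω₀ U₀ h).symm (restrictLinH Ω₀ J) : Site d → Fin d → 𝔸) = gopZdH η o Ω₀ U₀ J :=
  (gopZdH_of_regularAtH η o Ω₀ U₀ h J).symm

/-- ★ **`□₀Δ_a(U₀)□₀ (G_𝔤(U₀)J) = herm 𝟙_{Ω₀}J`** in the regime ((3.27) read forward). [cite: Balaban1985BackgroundPropagators, (3.27) p.395] -/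
theorem deltaADom_gopZdH (h : RegularAtH η o Ω₀ U₀) (J : Site d → Fin d → 𝔸) :
    deltaADom η o Ω₀ U₀ (gopZdH η o Ω₀ U₀ J) = (restrictLinH (𝔸 := 𝔸) Ω₀ J : Site d → Fin d → 𝔸) := by
  rw [← coe_deltaAEquivH_symm_gopZdH η o Ω₀ U₀ h J, ← deltaAEquivH_coe η o Ω₀ U₀ h, LinearEquiv.apply_symm_apply]

include hτp hτs in
/-- ★★ **[4] (2.22) ∕ (3.42) AT `n = 0`, AT ONE BACKGROUND: A LOWER FORM BOUND GIVES `‖G_𝔤(U₀)‖ ≤ c⁻¹`.**  If `Δ_a(U₀)↾Ω₀` is invertible on `E_𝔤(Ω₀)` (`RegularAtH`)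
and `c·⟨A, A⟩_τ ≤ ⟨A, Δ_a(U₀)A⟩_τ` on `E_𝔤(Ω₀)` (`c > 0`, finite `Ω₀`), then for EVERY bond field `J`: `⟨G_𝔤(U₀)J, G_𝔤(U₀)J⟩_τ ≤ c⁻²·⟨J̃, J̃⟩_τ` with
`J̃ = herm 𝟙_{Ω₀}J` — since `⟨GJ, Δ_a GJ⟩_τ = ⟨GJ, J̃⟩_τ ≤ ‖GJ‖_τ‖J̃‖_τ` (Cauchy–Schwarz, §1).
[cite: Balaban1985BackgroundPropagators, Thm 3.3 p.399, (3.42) p.397, (3.27) p.395; Balaban1984PropagatorsII, p.226, (2.22)] -/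
theorem bondPair_gopZdH_self_le_of_coercive (hΩ : Ω₀.Finite) (h : RegularAtH η o Ω₀ U₀) {c : ℝ} (hc : 0 < c)
    (hcoer : ∀ A ∈ domSubH (𝔸 := 𝔸) Ω₀, c * bondPair τ A A ≤ bondPair τ A (deltaAOf η o U₀ A)) (J : Site d → Fin d → 𝔸) :
    bondPair τ (gopZdH η o Ω₀ U₀ J) (gopZdH η o Ω₀ U₀ J) ≤
      c⁻¹ ^ 2 * bondPair τ (restrictLinH (𝔸 := 𝔸) Ω₀ J : Site d → Fin d → 𝔸) (restrictLinH (𝔸 := 𝔸) Ω₀ J : Site d → Fin d → 𝔸) := by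
  classical
  set A : Site d → Fin d → 𝔸 := gopZdH η o Ω₀ U₀ J with hAdef
  set Jt : Site d → Fin d → 𝔸 := (restrictLinH (𝔸 := 𝔸) Ω₀ J : Site d → Fin d → 𝔸) with hJt
  have hA : A ∈ domSubH (𝔸 := 𝔸) Ω₀ := gopZdH_mem_domSubH η o Ω₀ U₀ J
  have hJtmem : Jt ∈ domSubH (𝔸 := 𝔸) Ω₀ := (restrictLinH (𝔸 := 𝔸) Ω₀ J).2
  -- `⟨A, Δ_a A⟩ = ⟨A, J̃⟩`
  have hpair : bondPair τ A (deltaAOf η o U₀ A) = bondPair τ A Jt := by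
    rw [← bondPair_restrictDom_right τ (domSubH_le Ω₀ hA) (deltaAOf η o U₀ A)]
    show bondPair τ A (deltaADom η o Ω₀ U₀ A) = bondPair τ A Jt
    rw [hAdef, deltaADom_gopZdH η o Ω₀ U₀ h J]
  -- Cauchy–Schwarz on the finite bond set of `Ω₀`
  let T : Finset (Site d × Fin d) := (setOf_bondTouches_finite (d := d) hΩ).toFinset
  have hvanA : ∀ b : Site d × Fin d, b ∉ T → A b.1 b.2 = 0 := fun b hb => eq_zero_of_not_mem_bondFinset hΩ (domSubH_le Ω₀ hA) b hb
  have hvanJ : ∀ b : Site d × Fin d, b ∉ T → Jt b.1 b.2 = 0 := fun b hb => eq_zero_of_not_mem_bondFinset hΩ (domSubH_le Ω₀ hJtmem) b hb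
  have hCS := bondPair_sq_le τ hτp hτs T hvanA hvanJ
  have haa : 0 ≤ bondPair τ A A := bondPair_self_nonneg_of_vanish_off τ hτp T hvanA
  have hjj : 0 ≤ bondPair τ Jt Jt := bondPair_self_nonneg_of_vanish_off τ hτp T hvanJ
  have hco := hcoer A hA
  rw [hpair] at hco
  -- `c·a ≤ ⟨A, J̃⟩`, `⟨A, J̃⟩² ≤ a·j` ⟹ `a ≤ j∕c²`
  have hc2 : 0 < c ^ 2 := by positivity
  have key : c ^ 2 * bondPair τ A A ≤ bondPair τ Jt Jt := by
    by_cases ha0 : bondPair τ A A = 0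
    · rw [ha0, mul_zero]; exact hjj
    · have hapos : 0 < bondPair τ A A := lt_of_le_of_ne haa (Ne.symm ha0)
      have h1 : (c * bondPair τ A A) ^ 2 ≤ bondPair τ A A * bondPair τ Jt Jt := by
        have hnn : 0 ≤ c * bondPair τ A A := by positivity
        calc (c * bondPair τ A A) ^ 2 ≤ (bondPair τ A Jt) ^ 2 := pow_le_pow_left₀ hnn hco 2
          _ ≤ bondPair τ A A * bondPair τ Jt Jt := hCS
      have h2 : c ^ 2 * bondPair τ A A * bondPair τ A A ≤ bondPair τ Jt Jt * bondPair τ A A := by nlinarith [h1]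
      exact le_of_mul_le_mul_right h2 hapos
  rw [inv_pow, ← div_eq_inv_mul, le_div_iff₀ hc2]
  linarith [key]

include hτp hτs in
/-- ★★ **THE SAME FOR `J ∈ E_𝔤(Ω₀)`** (Hermitian, supported on the bonds of `Ω₀`, so `herm 𝟙_{Ω₀}J = J`): `⟨G_𝔤(U₀)J, G_𝔤(U₀)J⟩_τ ≤ c⁻²·⟨J, J⟩_τ`, i.e.
`‖G_𝔤(U₀)‖_{L²_τ(E_𝔤(Ω₀)) → L²_τ} ≤ c⁻¹`. [cite: Balaban1985BackgroundPropagators, Thm 3.3 p.399, (3.42) p.397; Balaban1984PropagatorsII, (2.22) p.226] -/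
theorem bondPair_gopZdH_self_le_of_coercive_of_mem (hΩ : Ω₀.Finite) (h : RegularAtH η o Ω₀ U₀) {c : ℝ} (hc : 0 < c)
    (hcoer : ∀ A ∈ domSubH (𝔸 := 𝔸) Ω₀, c * bondPair τ A A ≤ bondPair τ A (deltaAOf η o U₀ A)) {J : Site d → Fin d → 𝔸}
    (hJ : J ∈ domSubH (𝔸 := 𝔸) Ω₀) :
    bondPair τ (gopZdH η o Ω₀ U₀ J) (gopZdH η o Ω₀ U₀ J) ≤ c⁻¹ ^ 2 * bondPair τ J J := by
  have hb := bondPair_gopZdH_self_le_of_coercive τ hτp hτs η o Ω₀ U₀ hΩ h hc hcoer J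
  have hJt : (restrictLinH (𝔸 := 𝔸) Ω₀ J : Site d → Fin d → 𝔸) = J := by
    rw [restrictLinH_coe_of_herm Ω₀ (fun y μ _ => hJ.2 y μ), restrictDom_eq_self_of_mem Ω₀ hJ.1]
  rwa [hJt] at hb

end OneBackground

/-! ## §3  Cube members: ONE `L²_τ` bound for the genuine `G_𝔤(U₀)` at every small field near the member -/

section Cube

variable [FiniteDimensional ℝ 𝔸] [Nontrivial 𝔸] {L : ℕ}
variable (τ : 𝔸 →ₗ[ℂ] ℂ) (hτp : ∀ a : 𝔸, a ≠ 0 → 0 < (τ (star a * a)).re)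
  (hτt : ∀ a b : 𝔸, τ (a * b) = τ (b * a)) (hτs : ∀ a : 𝔸, τ (star a) = starRingEnd ℂ (τ a))

include hτp hτt hτs in
/-- ★★★★ **[B9] THEOREM 3.3's (3.42) AT `n = 0` AS AN `L²_τ` OPERATOR BOUND, AT ONE CUBE MEMBER, FOR EVERY SMALL FIELD NEAR IT**: at a cube member of
[Balaban1985RegularSpaces] (1.131) (`Ω = cubeFam false L a Mc ρ k`, `Λs = cubeLamS …`, every truncation `m ≤ k`, `2 ≤ d`, `2 ≤ L ≤ ρ`), for print's class `cubeLamBP` and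
a faithful Hermitian tracial `τ` on a finite-dimensional fibre, THERE ARE `α > 0` AND `c > 0` (member-dependent) such that for EVERY unitary `U₀` whose plaquette
variables satisfy `‖U₀(∂p) − 1‖ < α` on the plaquettes of `□₀ ± 3` and every Hermitian `J ∈ E(□₀)`:
`⟨G_𝔤(U₀)J, G_𝔤(U₀)J⟩_τ ≤ c⁻²·⟨J, J⟩_τ`, i.e. `‖G_𝔤(U₀)‖_{L²_τ → L²_τ} ≤ c⁻¹`, where `G_𝔤(U₀) = (□₀Δ_a(U₀)□₀)⁻¹` is the genuine propagator of the four-letter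
`Δ_a` of `opsAllZd` (dag-n06-b's `gopZdH`) — [4] (2.22)'s «hence» run on `B9Thm311CoerciveCompactZd`'s constant.
[cite: Balaban1985BackgroundPropagators, Thm 3.3 p.399, (3.42) p.397, (3.27) p.395, Thm 3.11 p.416; Balaban1984PropagatorsII, p.226, (2.22); Balaban1985RegularSpaces, (1.7) p.77, (1.131) p.99] -/
theorem exists_L2Bound_gopZdH_of_pdevOn_lt_cube (hd2 : 2 ≤ d) (hL : 2 ≤ L) (ops₀ : ℝ → ZdIdx d L → ℕ → OpsZd d 𝔸) (M : ℝ) (i : ZdIdx d L)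
    {a : Site d} {Mc ρ : ℕ} (hρ : L ≤ ρ) (hΩ : i.Ω = cubeFam false L a Mc ρ i.k) (hΛs : i.Λs = cubeLamS L a Mc ρ i.k) {m : ℕ} (hm : m ≤ i.k) :
    ∃ α : ℝ, 0 < α ∧ ∃ c : ℝ, 0 < c ∧ ∀ U₀ : Site d → Fin d → 𝔸ˣ, (∀ x κ, U₀ x κ ∈ unitaryUnits 𝔸) →
      pdevOn (fun i' => sqLo L a ρ i.k 0 i' - 3) (fun i' => sqHi L a Mc ρ i.k 0 i' + 3) U₀ < α →
        ∀ J ∈ domSubH (𝔸 := 𝔸) (i.Ω 0),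
          bondPair τ (gopZdH i.η (opsAllZd τ L (cubeLamBP L a Mc ρ i.k) ops₀ M i m) (i.Ω 0) U₀ J)
              (gopZdH i.η (opsAllZd τ L (cubeLamBP L a Mc ρ i.k) ops₀ M i m) (i.Ω 0) U₀ J) ≤ c⁻¹ ^ 2 * bondPair τ J J := by
  have hfin : (i.Ω 0).Finite := cubeMember_Ω0_finite i hΩ
  obtain ⟨α, hα, c, hc, h⟩ := exists_coercive_and_regularAtH_of_pdevOn_lt_cube τ hτp hτt hτs hd2 hL ops₀ M i hρ hΩ hΛs hm
  refine ⟨α, hα, c, hc, fun U₀ hU₀ hsmall J hJ => ?_⟩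
  obtain ⟨hcoer, hreg, -⟩ := h U₀ hU₀ hsmall
  exact bondPair_gopZdH_self_le_of_coercive_of_mem τ hτp hτs i.η (opsAllZd τ L (cubeLamBP L a Mc ρ i.k) ops₀ M i m) (i.Ω 0) U₀ hfin hreg hc hcoer hJ

include hτp hτt hτs in
/-- **A6 ∕ NON-VACUITY**: the bound at the flat background `U₀ = 1` (which meets `pdevOn … 1 = 0 < α` at every member), with the member's constant.
[cite: Balaban1985BackgroundPropagators, Thm 3.3 p.399; Balaban1984PropagatorsII, (2.11) p.225, (2.22) p.226] -/
theorem L2Bound_gopZdH_one_cube (hd2 : 2 ≤ d) (hL : 2 ≤ L) (ops₀ : ℝ → ZdIdx d L → ℕ → OpsZd d 𝔸) (M : ℝ) (i : ZdIdx d L)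
    {a : Site d} {Mc ρ : ℕ} (hρ : L ≤ ρ) (hΩ : i.Ω = cubeFam false L a Mc ρ i.k) (hΛs : i.Λs = cubeLamS L a Mc ρ i.k) {m : ℕ} (hm : m ≤ i.k) :
    ∃ c : ℝ, 0 < c ∧ ∀ J ∈ domSubH (𝔸 := 𝔸) (i.Ω 0),
      bondPair τ (gopZdH i.η (opsAllZd τ L (cubeLamBP L a Mc ρ i.k) ops₀ M i m) (i.Ω 0) 1 J)
          (gopZdH i.η (opsAllZd τ L (cubeLamBP L a Mc ρ i.k) ops₀ M i m) (i.Ω 0) 1 J) ≤ c⁻¹ ^ 2 * bondPair τ J J := by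
  obtain ⟨α, hα, c, hc, h⟩ := exists_L2Bound_gopZdH_of_pdevOn_lt_cube τ hτp hτt hτs hd2 hL ops₀ M i hρ hΩ hΛs hm
  refine ⟨c, hc, h 1 (fun _ _ => ?_) (by rw [pdevOn_one]; exact hα)⟩
  show ((1 : 𝔸ˣ) : 𝔸) ∈ unitary 𝔸
  rw [Units.val_one]
  exact one_mem _

end Cube

end Literature.MathematicalPhysics.QuantumFieldTheory.Balaban1983to89.B9Thm33GreenL2BoundCubeZd

end
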